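import Literature.AlgebraicGeometry.Resolution.Eliminations
import Literature.AlgebraicGeometry.Resolution.PermissibleBlowupHsFunMono
import Literature.AlgebraicGeometry.Resolution.BlowupReducedDimension
import Literature.AlgebraicGeometry.Resolution.QuasiExcellentSchemes
import Literature.AlgebraicGeometry.Resolution.ExcellentRingsFieldProofs
import Mathlib.AlgebraicGeometry.Morphisms.Proper
import Mathlib.AlgebraicGeometry.Noetherian
import HarnessLib

/-!
# From CJS `ν`-eliminations (Def. 6.14, literally) to the data of the open core stub
# (crux `SigmaMaxModifications`, stmt-ResolutionOfSingularities-18506, line `Sketch`)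

The lead skeleton of the crux isolates its open content in ONE stub, `stub_nuEliminationsExist`:
for `X/k` reduced, separated, locally of finite type and quasi-compact, `N ≥ dim X` and a maximal
value `ν ≠ Φ^{(N)}` of `Σ_X`, a blow-up sequence `s : CentreSeq X` with (a) centres OVER the
stratum `X(ν)`, (b) `H^N` non-increasing along `s.comp`, (c) `ν ∉ Σ_{s.top}`. This file PROVES
that the tree's literal rendering of Cossart–Jannsen–Saito, LNM 2270, Def. 6.14
(`CentreSeq.IsNuElimination N ν s`: all centres PERMISSIBLE, the `i`-th centre INSIDE the stratum
`X_i(ν)` of its own stage, `X_n(ν) = ∅`) supplies exactly that data, GIVEN the named fact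
`CossartJannsenSaito2020_thm_3_10_1` (Bennett–Hironaka–Singh: `H^N` does not increase under a
permissible blow-up of an excellent scheme; CJS Thm. 3.10 (1)):

* `hsFun_top_le_of_allPermissible` — (b): iterate Thm. 3.10 (1) along a sequence of permissible
  blow-ups of a scheme locally of finite type over a field (every stage is again locally of
  finite type over `k`, hence excellent, `Scheme.isExcellent_of_locallyOfFiniteType`; the
  dimension bound persists, `IsBlowup.topologicalKrullDim_le_of_isLocallyNoetherian`);
* `centresOver_hsStratum_of_centresInStratum` — (a): if nothing in `Σ_X` lies strictly above
  `ν` (e.g. `ν` maximal), a point of a later stage with value `ν` lies over `X(ν)` by (b), so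
  centres inside the strata `X_i(ν)` lie over `X(ν)`; the hypothesis propagates along the
  sequence by (b);
* `nuEliminationData_of_isNuElimination` — (a) ∧ (b) ∧ (c) for a `ν`-elimination of a maximal
  `ν`;
* `nuEliminationsExist_of_isNuElimination` — hence the STATEMENT of `stub_nuEliminationsExist`
  follows from Thm. 3.10 (1) and the existence of `ν`-eliminations in the sense of Def. 6.14 for
  every maximal `ν ≠ Φ^{(N)}` (CJS Thm. 6.28 in dimension `≤ 2`; Rem. 6.29's open question in
  general) — the open core in the monograph's own words.

No new definitions, no new named facts; the Bennett–Hironaka–Singh inequality enters as the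
explicit hypothesis `(h310 : CossartJannsenSaito2020_thm_3_10_1)` (its point-centre case is
proved in the tree, `PsiBlowup.lean`).

## Sources

* V. Cossart, U. Jannsen, S. Saito, LNM 2270 (2020), Def. 3.1, Thm. 3.10 (1), Def. 6.14,
  Thm. 6.28, Rem. 6.29. [CossartJannsenSaito2020]
* B. M. Bennett, Ann. of Math. 91 (1970), Thm. (2). [Bennett1970]
-/

set_option linter.dupNamespace false -- mandated namespace of this single-conjunct summit

noncomputable section

open CategoryTheory AlgebraicGeometry TopologicalSpace
open Literature.AlgebraicGeometry.Resolution Literature.RingTheory.HilbertSamuel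

namespace Summit.ResolutionOfSingularities.ResolutionOfSingularities.Theorems.SigmaMaxModifications.Sketch

/-- **`H^N` does not increase along a sequence of permissible blow-ups** of a scheme locally of
finite type over a field, of dimension `≤ N` (CJS Thm. 3.10 (1) = Bennett–Hironaka–Singh,
iterated; every stage is locally of finite type over `k`, hence excellent, and of dimension
`≤ N`). Conditional on the named fact `CossartJannsenSaito2020_thm_3_10_1`.
[cite: CossartJannsenSaito2020, Thm. 3.10 (1)] -/
theorem hsFun_top_le_of_allPermissible (h310 : CossartJannsenSaito2020_thm_3_10_1.{0})
    {k : Type} [Field k] :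
    ∀ {X : Scheme.{0}} (f : X ⟶ Spec (.of k)) [LocallyOfFiniteType f] (s : CentreSeq X) {N : ℕ},
      topologicalKrullDim X ≤ (N : WithBot ℕ∞) → s.AllPermissible →
        ∀ x' : s.top, Scheme.hsFun s.top N x' ≤ Scheme.hsFun X N (s.comp.base x')
  | _, _, _, CentreSeq.nil _, _, _, _, _ => le_rfl
  | X, f, _, CentreSeq.cons C rest, N, hdim, hperm, x' => by
    haveI : IsLocallyNoetherian X := LocallyOfFiniteType.isLocallyNoetherian f
    have hexc : Scheme.IsExcellent X :=
      Scheme.isExcellent_of_locallyOfFiniteType Stacks07QW_field_holds f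
    haveI : IsProper (blowup.π C) := (blowup.isBlowup C).isProper
    have hdim₁ : topologicalKrullDim (blowup C) ≤ (N : WithBot ℕ∞) :=
      (blowup.isBlowup C).topologicalKrullDim_le_of_isLocallyNoetherian hdim
    have h₁ : ∀ y : blowup C,
        Scheme.hsFun (blowup C) N y ≤ Scheme.hsFun X N ((blowup.π C).base y) := fun y =>
      hsFun_le_of_isPermissibleBlowup h310
        (CentreSeq.isPermissibleBlowup_of_allPermissible C rest hperm) hexc hdim y
    have ih := hsFun_top_le_of_allPermissible h310 (blowup.π C ≫ f) rest hdim₁ hperm.2 x'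
    exact ih.trans (h₁ _)

/-- **Centres inside the strata `X_i(ν)` lie over `X(ν)`** along a sequence of permissible
blow-ups (finite type over a field, dimension `≤ N`), provided no value of `Σ_X` lies strictly
above `ν` (e.g. `ν ∈ Σ_X^max`): a point `y` of a later stage with `H(y) = ν` has
`ν = H(y) ≤ H(π y)`, hence `H(π y) = ν`; and the proviso propagates to the blown-up scheme by
the same inequality. Conditional on `CossartJannsenSaito2020_thm_3_10_1`.
[cite: CossartJannsenSaito2020, Def. 6.14, Thm. 3.10 (1)] -/
theorem centresOver_hsStratum_of_centresInStratum (h310 : CossartJannsenSaito2020_thm_3_10_1.{0})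
    {k : Type} [Field k] :
    ∀ {X : Scheme.{0}} (f : X ⟶ Spec (.of k)) [LocallyOfFiniteType f] (s : CentreSeq X) {N : ℕ}
      {ν : ℕ → ℕ}, topologicalKrullDim X ≤ (N : WithBot ℕ∞) → s.AllPermissible →
      s.CentresInStratum N ν → (∀ x : X, ν ≤ Scheme.hsFun X N x → Scheme.hsFun X N x = ν) →
        s.CentresOver (Scheme.hsStratum X N ν)
  | _, _, _, CentreSeq.nil _, _, _, _, _, _, _ => trivial
  | X, f, _, CentreSeq.cons C rest, N, ν, hdim, hperm, hstrat, hν => by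
    haveI : IsLocallyNoetherian X := LocallyOfFiniteType.isLocallyNoetherian f
    have hexc : Scheme.IsExcellent X :=
      Scheme.isExcellent_of_locallyOfFiniteType Stacks07QW_field_holds f
    haveI : IsProper (blowup.π C) := (blowup.isBlowup C).isProper
    have hdim₁ : topologicalKrullDim (blowup C) ≤ (N : WithBot ℕ∞) :=
      (blowup.isBlowup C).topologicalKrullDim_le_of_isLocallyNoetherian hdim
    have h₁ : ∀ y : blowup C,
        Scheme.hsFun (blowup C) N y ≤ Scheme.hsFun X N ((blowup.π C).base y) := fun y =>
      hsFun_le_of_isPermissibleBlowup h310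
        (CentreSeq.isPermissibleBlowup_of_allPermissible C rest hperm) hexc hdim y
    -- the image of a point with value `≥ ν` has value `ν`, so the point has value `ν` too
    have hν₁ : ∀ y : blowup C, ν ≤ Scheme.hsFun (blowup C) N y →
        Scheme.hsFun (blowup C) N y = ν := fun y hy =>
      le_antisymm ((h₁ y).trans (hν _ (hy.trans (h₁ y))).le) hy
    have ih := centresOver_hsStratum_of_centresInStratum h310 (blowup.π C ≫ f) rest hdim₁ hperm.2
      hstrat.2 hν₁
    refine (CentreSeq.centresOver_cons C rest _).mpr ⟨hstrat.1, CentreSeq.CentresOver.mono rest ?_ ih⟩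
    intro y hy
    rw [Scheme.mem_hsStratum_iff] at hy
    rw [Set.mem_preimage, Scheme.mem_hsStratum_iff]
    exact hν _ (hy ▸ h₁ y)

/-- **A `ν`-elimination in the sense of CJS Def. 6.14 carries the data of the open core stub**:
for `ν ∈ Σ_X^max` and `s` a `ν`-elimination (`CentreSeq.IsNuElimination N ν s`) of a scheme
locally of finite type over a field, of dimension `≤ N`: the centres lie over `X(ν)`, `H^N` does
not increase along `s.comp`, and `ν ∉ Σ_{s.top}`. Conditional on
`CossartJannsenSaito2020_thm_3_10_1`. [cite: CossartJannsenSaito2020, Def. 6.14, Thm. 3.10 (1)] -/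
theorem nuEliminationData_of_isNuElimination (h310 : CossartJannsenSaito2020_thm_3_10_1.{0})
    {k : Type} [Field k] {X : Scheme.{0}} (f : X ⟶ Spec (.of k)) [LocallyOfFiniteType f]
    {N : ℕ} (hdim : topologicalKrullDim X ≤ (N : WithBot ℕ∞)) {ν : ℕ → ℕ}
    (hν : Maximal (· ∈ Scheme.hsValues X N) ν) (s : CentreSeq X) (hs : s.IsNuElimination N ν) :
    s.CentresOver (Scheme.hsStratum X N ν) ∧
      (∀ x' : s.top, Scheme.hsFun s.top N x' ≤ Scheme.hsFun X N (s.comp.base x')) ∧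
      ν ∉ Scheme.hsValues s.top N :=
  ⟨centresOver_hsStratum_of_centresInStratum h310 f s hdim hs.1 hs.2.1 fun x hx =>
      le_antisymm (hν.2 ⟨x, rfl⟩ hx) hx,
    hsFun_top_le_of_allPermissible h310 f s hdim hs.1, hs.not_mem_hsValues_top⟩

/-- **The open core in the monograph's own words.** The statement of the lead skeleton's stub
`stub_nuEliminationsExist` follows from the Bennett–Hironaka–Singh inequality (CJS Thm. 3.10 (1),
named fact) together with: every reduced `X`, locally of finite type and quasi-compact over a
field, of dimension `≤ N`, admits for every maximal value `ν ≠ Φ^{(N)}` of `Σ_X` a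
`ν`-ELIMINATION in the sense of CJS Def. 6.14 (`CentreSeq.IsNuElimination`: permissible centres
inside the successive strata `X_i(ν)`, ending with `X_n(ν) = ∅`) — CJS Thm. 6.28 in dimension
`≤ 2`, and the question of Rem. 6.29 (1) in general. [cite: CossartJannsenSaito2020, Def. 6.14, Thm. 6.28, Rem. 6.29] -/
theorem nuEliminationsExist_of_isNuElimination :
    CossartJannsenSaito2020_thm_3_10_1.{0} →
    (∀ (k : Type) [Field k] (X : Scheme.{0}) (f : X ⟶ Spec (.of k)), LocallyOfFiniteType f →
      QuasiCompact f → IsReduced X → ∀ N : ℕ, topologicalKrullDim X ≤ (N : WithBot ℕ∞) →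
      ∀ ν : ℕ → ℕ, Maximal (· ∈ Scheme.hsValues X N) ν → ν ≠ iterPSum N Phi →
        ∃ s : CentreSeq X, s.IsNuElimination N ν) →
    ∀ p : ℕ, p.Prime → ∀ (k : Type) [Field k] [CharP k p] (X : Scheme.{0})
      (f : X ⟶ Spec (.of k)), IsSeparated f → LocallyOfFiniteType f → QuasiCompact f →
      IsReduced X → ∀ N : ℕ, topologicalKrullDim X ≤ (N : WithBot ℕ∞) →
      ∀ ν : ℕ → ℕ, Maximal (· ∈ Scheme.hsValues X N) ν → ν ≠ iterPSum N Phi →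
        ∃ s : CentreSeq X, s.CentresOver (Scheme.hsStratum X N ν) ∧
          (∀ x' : s.top, Scheme.hsFun s.top N x' ≤ Scheme.hsFun X N (s.comp.base x')) ∧
          ν ∉ Scheme.hsValues s.top N := by
  intro h310 H _p _hp k _ _ X f _hsep hft hqc hred N hdim ν hν hνΦ
  haveI := hft
  obtain ⟨s, hs⟩ := H k X f hft hqc hred N hdim ν hν hνΦ
  exact ⟨s, nuEliminationData_of_isNuElimination h310 f hdim hν s hs⟩

end Summit.ResolutionOfSingularities.ResolutionOfSingularities.Theorems.SigmaMaxModifications.Sketch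

end
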